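import Summits.RiemannHypothesis.RiemannHypothesis.Theorems.LiPrimeEchoNonresonantTerms
import HarnessLib

/-!
# RiemannHypothesis / LiPrimeEcho — crux K2 `LiPrimeEdgeEcho`, part 3: the non-resonant remainder is `O_c(1)` (RH-FREE)

RH-FREE [rh-li-prover].  Route `Theses/LiPrimeEcho.lean` (rung «Li PRIME-ECHO LAW» `LiTheory.LiZeroWindowEcho`), item
`LiPrimeEdgeEcho` (stmt-RiemannHypothesis-19245), stub E₂ of the birth skeleton (`stub_nonresonant`): for `c ≥ 1` there is
`C = C(c)` with

  `|liPrimeEdge n T₁ T₂ − edgeTwo n T₁ T₂| ≤ C`   (`n ≥ 1`, `√n ≤ T₁ ≤ T₂ ≤ c√n + 1`),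

i.e. everything on the prime edge except the `m = 2` term against `F_n(1 − w)` is bounded.  Proof: `L(Λ, w) k_n(w)
= Σ_m Λ(m) m^{−w}(zⁿ + z⁻ⁿ)` converges absolutely and uniformly on `Re w = 3/2` (`|zⁿ| ≤ 1`, `|z⁻ⁿ| ≤ e`), so the
integral is the sum of the term integrals (dominated convergence); each term is bounded by part 2
(`norm_integral_plus_le`, `norm_integral_minus_le`) by `O_c(Λ(m) m^{−3/2})`, and `Σ Λ(m) m^{−3/2} < ∞`.
Nothing here bears on the truth of RH.
-/

noncomputable section

-- D-0017: `Summit.<S>.<S>.…` is the designed namespace of a single-problem summit.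
set_option linter.dupNamespace false

open Complex MeasureTheory intervalIntegral Set
open scoped Real Interval ArithmeticFunction.vonMangoldt

namespace Summit.RiemannHypothesis.RiemannHypothesis.Theorems.LiTheory

namespace PrimeEdge

/-- `Σ_m Λ(m) m^{−3/2} < ∞`. -/
theorem summable_norm_term : Summable fun m : ℕ ↦ ‖LSeries.term (fun m ↦ (Λ m : ℂ)) (3 / 2 : ℂ) m‖ := by
  have h : (1 : ℝ) < (3 / 2 : ℂ).re := by norm_num
  exact (ArithmeticFunction.LSeriesSummable_vonMangoldt h).norm

/-- `‖Λ(m) m^{−w}‖ = ‖Λ(m) m^{−3/2}‖` on the edge. -/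
theorem norm_term_rightPt (y : ℝ) (m : ℕ) :
    ‖LSeries.term (fun m ↦ (Λ m : ℂ)) (liRightPt y) m‖ = ‖LSeries.term (fun m ↦ (Λ m : ℂ)) (3 / 2 : ℂ) m‖ := by
  simp only [LSeries.norm_term_eq, liRightPt_re]
  norm_num

/-- `Λ(m) m^{−w}` as a product. -/
theorem term_eq (y : ℝ) (m : ℕ) :
    LSeries.term (fun m ↦ (Λ m : ℂ)) (liRightPt y) m = (Λ m : ℂ) * (m : ℂ) ^ (-liRightPt y) :=
  LSeries.term_def₀ (by simp) _ _

/-- `‖Λ(m) m^{−3/2}‖ = Λ(m) m^{−3/2}` (`m ≥ 1`). -/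
theorem norm_term_three_halves {m : ℕ} (hm : 0 < m) :
    ‖LSeries.term (fun m ↦ (Λ m : ℂ)) (3 / 2 : ℂ) m‖ = (Λ m : ℝ) * (m : ℝ) ^ (-(3 / 2 : ℝ)) := by
  rw [LSeries.norm_term_eq, if_neg hm.ne', Complex.norm_real, Real.norm_eq_abs,
    abs_of_nonneg ArithmeticFunction.vonMangoldt_nonneg, Real.rpow_neg (Nat.cast_nonneg m), div_eq_mul_inv]
  norm_num

/-- `z` is continuous in `y`. -/
theorem continuous_zq : Continuous zq := by
  unfold zq; exact continuous_const.sub (continuous_const.div continuous_liRightPt liRightPt_ne_zero)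

/-- `z⁻ⁿ` is continuous in `y`. -/
theorem continuous_zq_pow_inv (n : ℕ) : Continuous fun y ↦ (zq y ^ n)⁻¹ :=
  (continuous_zq.pow n).inv₀ fun y ↦ pow_ne_zero _ (zq_ne_zero y)

/-- `k_n(w)` is continuous in `y`. -/
theorem continuous_symWeight (n : ℕ) : Continuous fun y ↦ liSymWeight n (liRightPt y) := by
  simp_rw [liSymWeight_rightPt]; exact (continuous_zq.pow n).add (continuous_zq_pow_inv n)

/-- `Λ(m) m^{−w}` is continuous in `y`. -/
theorem continuous_term (m : ℕ) : Continuous fun y ↦ LSeries.term (fun m ↦ (Λ m : ℂ)) (liRightPt y) m := by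
  rcases Nat.eq_zero_or_pos m with rfl | hm
  · simp only [LSeries.term_zero]; exact continuous_const
  · simp_rw [term_eq]; exact continuous_const.mul (continuous_cpow_neg_rightPt hm)

/-- `Λ(0) = Λ(1) = 0`. -/
theorem vonMangoldt_eq_zero_of_lt_two {m : ℕ} (hm : m < 2) : (Λ m : ℝ) = 0 := by
  interval_cases m
  · exact ArithmeticFunction.map_zero
  · exact ArithmeticFunction.vonMangoldt_apply_one

/-- **Stub E₂ (`stub_nonresonant`) of the birth skeleton: the non-resonant remainder of the prime edge is `O_c(1)`.**
For `c ≥ 1` there is `C` with `|liPrimeEdge n T₁ T₂ − edgeTwo n T₁ T₂| ≤ C` whenever `n ≥ 1`, `√n ≤ T₁ ≤ T₂ ≤ c√n + 1`. -/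
theorem liPrimeEdge_nonresonant {c : ℝ} (hc : 1 ≤ c) :
    ∃ C : ℝ, ∀ n : ℕ, 1 ≤ n → ∀ T₁ T₂ : ℝ, Real.sqrt n ≤ T₁ → T₁ ≤ T₂ → T₂ ≤ c * Real.sqrt n + 1 →
      |liPrimeEdge n T₁ T₂ - edgeTwo n T₁ T₂| ≤ C := by
  set Kp : ℝ := 4 + 12 * (c + 1) with hKp
  set Km : ℝ := Real.exp 1 * (22 + 363 * (c + 1)) with hKm
  have hKp0 : 0 ≤ Kp := by rw [hKp]; nlinarith
  have hKm0 : 0 ≤ Km := by rw [hKm]; positivity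
  set f : ℕ → ℂ := fun m ↦ (Λ m : ℂ) with hf
  set S : ℝ := ∑' m : ℕ, ‖LSeries.term f (3 / 2 : ℂ) m‖ with hS
  refine ⟨1 / Real.pi * (S * (Kp + Km)), fun n hn T₁ T₂ h1 h12 h2 ↦ ?_⟩
  have hsum := summable_norm_term
  -- the term functions
  set F : ℕ → ℝ → ℂ := fun m y ↦ LSeries.term f (liRightPt y) m * liSymWeight n (liRightPt y) with hFdef
  set Tp : ℕ → ℝ → ℂ := fun m y ↦ (Λ m : ℂ) * ((m : ℂ) ^ (-liRightPt y) * zq y ^ n) with hTp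
  set Tm : ℕ → ℝ → ℂ := fun m y ↦ (Λ m : ℂ) * ((m : ℂ) ^ (-liRightPt y) * (zq y ^ n)⁻¹) with hTm
  have hF : ∀ m y, F m y = Tp m y + Tm m y := by
    intro m y; simp only [hFdef, hTp, hTm, hf, term_eq, liSymWeight_rightPt]; ring
  -- dominated convergence: `HasSum (∫ F m) (∫ L k_n)`
  have hJ : HasSum (fun m ↦ ∫ y in T₁..T₂, F m y)
      (∫ y in T₁..T₂, LSeries f (liRightPt y) * liSymWeight n (liRightPt y)) := by
    refine intervalIntegral.hasSum_integral_of_dominated_convergence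
      (fun m _ ↦ ‖LSeries.term f (3 / 2 : ℂ) m‖ * (1 + Real.exp 1)) ?_ ?_ ?_ ?_ ?_
    · intro m; exact ((continuous_term m).mul (continuous_symWeight n)).aestronglyMeasurable
    · intro m
      refine Filter.Eventually.of_forall fun y hy ↦ ?_
      rw [uIoc_of_le h12] at hy
      have hy' : Real.sqrt n ≤ y := h1.trans hy.1.le
      simp only [hFdef]
      rw [norm_mul, norm_term_rightPt]
      refine mul_le_mul_of_nonneg_left ?_ (norm_nonneg _)
      rw [liSymWeight_rightPt]
      exact (norm_add_le _ _).trans (add_le_add (norm_zq_pow_le_one n y) (norm_zq_pow_inv_le n hy'))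
    · refine Filter.Eventually.of_forall fun y _ ↦ ?_
      show Summable fun m ↦ ‖LSeries.term f (3 / 2 : ℂ) m‖ * (1 + Real.exp 1)
      exact hsum.mul_right (1 + Real.exp 1)
    · show IntervalIntegrable (fun _ : ℝ ↦ ∑' m : ℕ, ‖LSeries.term f (3 / 2 : ℂ) m‖ * (1 + Real.exp 1)) volume T₁ T₂
      exact intervalIntegrable_const
    · refine Filter.Eventually.of_forall fun y _ ↦ ?_
      have hre : (1 : ℝ) < (liRightPt y).re := by rw [liRightPt_re]; norm_num
      have hs : LSeriesSummable f (liRightPt y) := ArithmeticFunction.LSeriesSummable_vonMangoldt hre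
      show HasSum (fun m ↦ LSeries.term f (liRightPt y) m * liSymWeight n (liRightPt y))
        (LSeries f (liRightPt y) * liSymWeight n (liRightPt y))
      exact hs.hasSum.mul_right (liSymWeight n (liRightPt y))
  -- the term integrals split
  have hiTp : ∀ m, IntervalIntegrable (Tp m) volume T₁ T₂ := fun m ↦ by
    rcases Nat.eq_zero_or_pos m with rfl | hm
    · simp only [hTp, ArithmeticFunction.map_zero, Complex.ofReal_zero, zero_mul]; exact intervalIntegrable_const
    · exact (continuous_const.mul ((continuous_cpow_neg_rightPt hm).mul (continuous_zq.pow n))).intervalIntegrable _ _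
  have hiTm : ∀ m, IntervalIntegrable (Tm m) volume T₁ T₂ := fun m ↦ by
    rcases Nat.eq_zero_or_pos m with rfl | hm
    · simp only [hTm, ArithmeticFunction.map_zero, Complex.ofReal_zero, zero_mul]; exact intervalIntegrable_const
    · exact (continuous_const.mul ((continuous_cpow_neg_rightPt hm).mul (continuous_zq_pow_inv n))).intervalIntegrable
        _ _
  have hsplit : ∀ m, (∫ y in T₁..T₂, F m y) = (∫ y in T₁..T₂, Tp m y) + ∫ y in T₁..T₂, Tm m y := fun m ↦ by
    rw [← intervalIntegral.integral_add (hiTp m) (hiTm m)]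
    exact intervalIntegral.integral_congr fun y _ ↦ hF m y
  -- per-term bounds
  have hbTp : ∀ m, ‖∫ y in T₁..T₂, Tp m y‖ ≤ ‖LSeries.term f (3 / 2 : ℂ) m‖ * Kp := by
    intro m
    rcases lt_or_ge m 2 with hm | hm
    · have h0 := vonMangoldt_eq_zero_of_lt_two hm
      simp only [hTp, h0, Complex.ofReal_zero, zero_mul, intervalIntegral.integral_zero, norm_zero]
      positivity
    · have hm0 : 0 < m := by omega
      simp only [hTp]
      rw [intervalIntegral.integral_const_mul, norm_mul, norm_term_three_halves hm0, Complex.norm_real,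
        Real.norm_eq_abs, abs_of_nonneg ArithmeticFunction.vonMangoldt_nonneg, mul_assoc]
      exact mul_le_mul_of_nonneg_left (norm_integral_plus_le hc hn hm h1 h12 h2)
        ArithmeticFunction.vonMangoldt_nonneg
  have hbTm : ∀ m, m ≠ 2 → ‖∫ y in T₁..T₂, Tm m y‖ ≤ ‖LSeries.term f (3 / 2 : ℂ) m‖ * Km := by
    intro m hm2
    rcases lt_or_ge m 2 with hm | hm
    · have h0 := vonMangoldt_eq_zero_of_lt_two hm
      simp only [hTm, h0, Complex.ofReal_zero, zero_mul, intervalIntegral.integral_zero, norm_zero]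
      positivity
    · have hm3 : 3 ≤ m := by omega
      have hm0 : 0 < m := by omega
      simp only [hTm]
      rw [intervalIntegral.integral_const_mul, norm_mul, norm_term_three_halves hm0, Complex.norm_real,
        Real.norm_eq_abs, abs_of_nonneg ArithmeticFunction.vonMangoldt_nonneg, mul_assoc]
      exact mul_le_mul_of_nonneg_left (norm_integral_minus_le hc hn hm3 h1 h12 h2)
        ArithmeticFunction.vonMangoldt_nonneg
  -- assemble: `∫ L k_n − ∫ Tm 2 = Σ_m (∫ Tp m + [m ≠ 2] ∫ Tm m)`
  set J : ℂ := ∫ y in T₁..T₂, LSeries f (liRightPt y) * liSymWeight n (liRightPt y) with hJdef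
  set I2 : ℂ := ∫ y in T₁..T₂, Tm 2 y with hI2
  set G : ℕ → ℂ := fun m ↦ (∫ y in T₁..T₂, Tp m y) + if m = 2 then 0 else ∫ y in T₁..T₂, Tm m y with hG
  have hGsum : HasSum G (J - I2) := by
    have h2 := hasSum_ite_eq 2 I2
    have e : G = fun m ↦ (∫ y in T₁..T₂, F m y) - (if m = 2 then I2 else 0) := by
      funext m
      simp only [hG, hsplit]
      split_ifs with h
      · subst h; rw [hI2]; ring
      · ring
    rw [e]
    exact hJ.sub h2
  have hGb : ∀ m, ‖G m‖ ≤ ‖LSeries.term f (3 / 2 : ℂ) m‖ * (Kp + Km) := by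
    intro m
    simp only [hG]
    split_ifs with h
    · rw [add_zero, mul_add]
      have : 0 ≤ ‖LSeries.term f (3 / 2 : ℂ) m‖ * Km := by positivity
      linarith [hbTp m]
    · rw [mul_add]
      exact (norm_add_le _ _).trans (add_le_add (hbTp m) (hbTm m h))
  have hnorm : ‖J - I2‖ ≤ S * (Kp + Km) := by
    rw [← hGsum.tsum_eq]
    have := tsum_of_norm_bounded (hsum.mul_right (Kp + Km)).hasSum hGb
    rwa [tsum_mul_right] at this
  -- back to the real statement
  have hfinal : liPrimeEdge n T₁ T₂ - edgeTwo n T₁ T₂ = 1 / Real.pi * (J - I2).re := by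
    have hI2' : I2 = ∫ y in T₁..T₂, (Λ 2 : ℂ) * (2 : ℂ) ^ (-liRightPt y) * (zq y ^ n)⁻¹ := by
      rw [hI2]
      refine intervalIntegral.integral_congr fun y _ ↦ ?_
      simp only [hTm, Nat.cast_ofNat]
      ring
    unfold liPrimeEdge edgeTwo
    rw [Complex.sub_re, hI2', hJdef]
    ring
  rw [hfinal, abs_mul, abs_of_pos (by positivity : (0 : ℝ) < 1 / Real.pi)]
  refine mul_le_mul_of_nonneg_left ?_ (by positivity)
  exact (Complex.abs_re_le_norm _).trans hnorm

end PrimeEdge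

end Summit.RiemannHypothesis.RiemannHypothesis.Theorems.LiTheory
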